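import Mathlib
import Literature.Computability.AlgebraicComplexity.QuantumFunctionalsSemiInvariant
import Literature.Computability.AlgebraicComplexity.StabilizerTensorRank
import HarnessLib

/-!
# The sandwich symmetries of `⟨n,n,n⟩` and its Lie stabiliser in `gl ⊕ gl ⊕ gl`
# (de Groote 1978, Part I, infinitesimal form)

Everything here is PROVED; no named facts.

Let `M = ⟨n,n,n⟩ = matMulTensor K n n n` in Bläser's coordinates (`M (κ,ν) (κ',μ) (μ',ν') = 1` iff
`κ = κ'`, `μ = μ'`, `ν = ν'`: first leg the output entry `Z_{κν}`, second `X_{κμ}`, third `Y_{μν}`),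
acted on factorwise by triples of `n² × n²` matrices through the tree's `actTensor`
(`((A ⊗ B ⊗ C)·t)(a,b,c) = Σ A_{aa'} B_{bb'} C_{cc'} t(a',b',c')`). Index pairs `(i,j) ∈ Fin n × Fin n`
are the row/column of a matrix entry, so an `n² × n²` matrix of the form `U ⊗ₖ V`
(`Matrix.kronecker`, entry `U_{ik} V_{jl}` at `((i,j),(k,l))`) is the operator `X ↦ U X Vᵀ` on
`n × n` matrices.

* `actTensor_matMulTensor_apply` — `((A ⊗ B ⊗ C)·M)(a,b,c) = Σ_{κ,μ,ν} A_{a,(κ,ν)} B_{b,(κ,μ)} C_{c,(μ,ν)}`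
  (from the standard algorithm `matMulTensor_eq_sum_standard` of `StabilizerTensorRank.lean`).
* `actTensor_sandwich_matMulTensor` — the **sandwich symmetries**: for invertible `P, Q, R`,
  `(P⁻ᵀ ⊗ₖ R⁻ᵀ, P ⊗ₖ Q, Q⁻ᵀ ⊗ₖ R)` fixes `M` (the substitution `X ↦ Pᵀ X Q`, `Y ↦ Q⁻¹ Y Rᵀ`,
  `Z ↦ P⁻¹ Z R⁻¹`, under which `tr(Zᵀ X Y)` is invariant; de Groote 1978, I, §3: these generate the
  identity component of the isotropy group of `⟨n,n,n⟩`).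
* `lieAct_matMulTensor_apply` — the infinitesimal action
  `(ξ₁ ⊗ 1 ⊗ 1 + 1 ⊗ ξ₂ ⊗ 1 + 1 ⊗ 1 ⊗ ξ₃)·M` entrywise.
* `lieStab_matMulTensor_iff` — **the Lie stabiliser of `⟨n,n,n⟩`**: `(ξ₁, ξ₂, ξ₃)` annihilates `M`
  iff `ξ₁ = -(p ⊗ₖ 1 + 1 ⊗ₖ qᵀ)`, `ξ₂ = pᵀ ⊗ₖ 1 + 1 ⊗ₖ r`, `ξ₃ = -(rᵀ ⊗ₖ 1) + 1 ⊗ₖ q` for some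
  `n × n` matrices `p, q, r` — the tangent space at the identity of the sandwich group (derivative
  of `(P⁻ᵀ ⊗ R⁻ᵀ, P ⊗ Q, Q⁻ᵀ ⊗ R)` at `P = exp(εpᵀ)`, `Q = exp(εr)`, `R = exp(εq)`); in particular it
  has dimension `3n² - 1`. The proof is the direct solution of the linear system
  `[l=m] ξ₁_{(i,j),(k,o)} + [j=o] ξ₂_{(k,l),(i,m)} + [i=k] ξ₃_{(m,o),(l,j)} = 0`.

Consumer: the torus-straightening step of route MatrixMultiplication/ToricBorderRank, item
`HilbertMumfordHalf` (a diagonalisable one-parameter subgroup of the stabiliser of an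
`SL³`-translate of `⟨n,n,n⟩` is straightened into the diagonal torus by a sandwich symmetry).

## References

* H. F. de Groote, *On varieties of optimal algorithms for the computation of bilinear mappings.
  I. The isotropy group of a bilinear mapping*, Theoret. Comput. Sci. 7 (1978) 1–24, §3
  (isotropy group of matrix multiplication: sandwiching, transposition, scalars). [Degroote1978]
* P. Bürgisser, M. Clausen, M. A. Shokrollahi, *Algebraic Complexity Theory*, Springer 1997,
  (14.13)–(14.15) and Chap. 17 Notes (the sandwich action on algorithms for `k^{n×n}`).
-/

namespace Literature.Computability.AlgebraicComplexity

open scoped BigOperators Kronecker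
open Matrix

variable {K : Type*} [Field K] {n : ℕ}

/-! ### The action on `⟨n,n,n⟩` in coordinates -/

/-- The triple action is additive in the tensor. [folklore] -/
theorem actTensor_add_tensor {R : Type*} [CommSemiring R] {ι κ μ ι' κ' μ' : Type*} [Fintype ι]
    [Fintype κ] [Fintype μ] (A : Matrix ι' ι R) (B : Matrix κ' κ R) (C : Matrix μ' μ R)
    (s t : ι → κ → μ → R) : actTensor A B C (s + t) = actTensor A B C s + actTensor A B C t := by
  funext a b c
  simp only [actTensor_apply, Pi.add_apply, mul_add, Finset.sum_add_distrib]

/-- The triple action commutes with finite sums of tensors. [folklore] -/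
theorem actTensor_finset_sum_tensor {R : Type*} [CommSemiring R] {ι κ μ ι' κ' μ' : Type*}
    [Fintype ι] [Fintype κ] [Fintype μ] (A : Matrix ι' ι R) (B : Matrix κ' κ R) (C : Matrix μ' μ R)
    {σ : Type*} (s : Finset σ) (t : σ → ι → κ → μ → R) :
    actTensor A B C (∑ x ∈ s, t x) = ∑ x ∈ s, actTensor A B C (t x) := by
  classical
  induction s using Finset.induction_on with
  | empty => simp
  | insert x s hx ih => rw [Finset.sum_insert hx, Finset.sum_insert hx, actTensor_add_tensor, ih]

/-- **The action on `⟨n,n,n⟩` in coordinates**: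
`((A ⊗ B ⊗ C)·⟨n,n,n⟩)(a,b,c) = Σ_{κ,μ,ν} A_{a,(κ,ν)} B_{b,(κ,μ)} C_{c,(μ,ν)}`. [folklore] -/
theorem actTensor_matMulTensor_apply {R : Type*} [CommRing R]
    (A B C : Matrix (Fin n × Fin n) (Fin n × Fin n) R) (a b c : Fin n × Fin n) :
    actTensor A B C (matMulTensor R n n n) a b c =
      ∑ κ : Fin n, ∑ μ : Fin n, ∑ ν : Fin n, A a (κ, ν) * B b (κ, μ) * C c (μ, ν) := by
  rw [matMulTensor_eq_sum_standard, actTensor_finset_sum_tensor, Finset.sum_apply, Finset.sum_apply,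
    Finset.sum_apply, Fintype.sum_prod_type]
  refine Finset.sum_congr rfl fun κ _ => ?_
  rw [Fintype.sum_prod_type]
  refine Finset.sum_congr rfl fun μ _ => Finset.sum_congr rfl fun ν _ => ?_
  rw [actTensor_triad, triad_apply, Matrix.mulVec_single_one, Matrix.mulVec_single_one,
    Matrix.mulVec_single_one]
  rfl

/-! ### The sandwich symmetries -/

/-- **Sandwich symmetries of `⟨n,n,n⟩`** (de Groote 1978, I, §3): for invertible `n × n` matrices
`P, Q, R` the triple `(P⁻ᵀ ⊗ₖ R⁻ᵀ, P ⊗ₖ Q, Q⁻ᵀ ⊗ₖ R)` fixes the matrix multiplication tensor. In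
coordinates the three index sums factor as `(P P⁻¹)_{b₁a₁} (Q Q⁻¹)_{b₂c₁} (R R⁻¹)_{c₂a₂}`.
[cite: Degroote1978, §3 (Thm. 3.4 and the example 𝒜 = M_n(K))] -/
theorem actTensor_sandwich_matMulTensor (P Q R : Matrix (Fin n) (Fin n) K) (hP : IsUnit P.det)
    (hQ : IsUnit Q.det) (hR : IsUnit R.det) :
    actTensor (P⁻¹ᵀ ⊗ₖ R⁻¹ᵀ) (P ⊗ₖ Q) (Q⁻¹ᵀ ⊗ₖ R) (matMulTensor K n n n) =
      matMulTensor K n n n := by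
  funext a b c
  rw [actTensor_matMulTensor_apply]
  have hsummand : ∀ κ μ ν : Fin n, (P⁻¹ᵀ ⊗ₖ R⁻¹ᵀ) a (κ, ν) * (P ⊗ₖ Q) b (κ, μ) *
      (Q⁻¹ᵀ ⊗ₖ R) c (μ, ν) =
      (P b.1 κ * P⁻¹ κ a.1) * ((Q b.2 μ * Q⁻¹ μ c.1) * (R c.2 ν * R⁻¹ ν a.2)) := by
    intro κ μ ν
    obtain ⟨a₁, a₂⟩ := a
    obtain ⟨b₁, b₂⟩ := b
    obtain ⟨c₁, c₂⟩ := c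
    simp only [kronecker_apply, transpose_apply]
    ring
  simp_rw [hsummand, ← Finset.mul_sum, ← Finset.sum_mul]
  rw [← Matrix.mul_apply, ← Matrix.mul_apply, ← Matrix.mul_apply, Matrix.mul_nonsing_inv _ hP,
    Matrix.mul_nonsing_inv _ hQ, Matrix.mul_nonsing_inv _ hR]
  obtain ⟨a₁, a₂⟩ := a
  obtain ⟨b₁, b₂⟩ := b
  obtain ⟨c₁, c₂⟩ := c
  simp only [matMulTensor, Matrix.one_apply]
  by_cases h₁ : a₁ = b₁ <;> by_cases h₂ : b₂ = c₁ <;> by_cases h₃ : a₂ = c₂ <;>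
    simp [h₁, h₂, h₃, eq_comm]

/-! ### The Lie stabiliser -/

/-- **The infinitesimal action on `⟨n,n,n⟩`, entrywise**: at `a = (i,j)`, `b = (k,l)`, `c = (m,o)`,
`((ξ₁⊗1⊗1 + 1⊗ξ₂⊗1 + 1⊗1⊗ξ₃)·⟨n,n,n⟩)(a,b,c) = [l=m] ξ₁_{(i,j),(k,o)} + [j=o] ξ₂_{(k,l),(i,m)} + [i=k] ξ₃_{(m,o),(l,j)}`.
[folklore] -/
theorem lieAct_matMulTensor_apply {R : Type*} [CommRing R]
    (ξ₁ ξ₂ ξ₃ : Matrix (Fin n × Fin n) (Fin n × Fin n) R) (i j k l m o : Fin n) :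
    (actTensor ξ₁ (1 : Matrix (Fin n × Fin n) (Fin n × Fin n) R) 1 (matMulTensor R n n n) +
      actTensor (1 : Matrix (Fin n × Fin n) (Fin n × Fin n) R) ξ₂ 1 (matMulTensor R n n n) +
      actTensor (1 : Matrix (Fin n × Fin n) (Fin n × Fin n) R) 1 ξ₃ (matMulTensor R n n n) :
        Fin n × Fin n → Fin n × Fin n → Fin n × Fin n → R) (i, j) (k, l) (m, o) =
      (if l = m then ξ₁ (i, j) (k, o) else 0) + (if j = o then ξ₂ (k, l) (i, m) else 0) +
        (if i = k then ξ₃ (m, o) (l, j) else 0) := by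
  simp only [Pi.add_apply]
  rw [actTensor_fst_apply, actTensor_snd_apply, actTensor_thd_apply]
  congr 1
  congr 1
  · -- first leg: `Σ_{a'} ξ₁ (i,j) a' [a'.1 = k ∧ l = m ∧ a'.2 = o]`
    rw [Fintype.sum_prod_type]
    simp only [matMulTensor, mul_ite, mul_one, mul_zero]
    rw [Finset.sum_eq_single k]
    · rw [Finset.sum_eq_single o]
      · by_cases h : l = m <;> simp [h]
      · intro ν _ hν; simp [hν]
      · intro h; exact absurd (Finset.mem_univ o) h
    · intro κ _ hκ
      exact Finset.sum_eq_zero fun ν _ => by simp [hκ]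
    · intro h; exact absurd (Finset.mem_univ k) h
  · -- second leg: `Σ_{b'} ξ₂ (k,l) b' [i = b'.1 ∧ b'.2 = m ∧ j = o]`
    rw [Fintype.sum_prod_type]
    simp only [matMulTensor, mul_ite, mul_one, mul_zero]
    rw [Finset.sum_eq_single i]
    · rw [Finset.sum_eq_single m]
      · by_cases h : j = o <;> simp [h]
      · intro μ _ hμ; simp [hμ]
      · intro h; exact absurd (Finset.mem_univ m) h
    · intro κ _ hκ
      exact Finset.sum_eq_zero fun μ _ => by simp [Ne.symm hκ]
    · intro h; exact absurd (Finset.mem_univ i) h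
  · -- third leg: `Σ_{c'} ξ₃ (m,o) c' [i = k ∧ l = c'.1 ∧ j = c'.2]`
    rw [Fintype.sum_prod_type]
    simp only [matMulTensor, mul_ite, mul_one, mul_zero]
    rw [Finset.sum_eq_single l]
    · rw [Finset.sum_eq_single j]
      · by_cases h : i = k <;> simp [h]
      · intro ν _ hν; simp [Ne.symm hν]
      · intro h; exact absurd (Finset.mem_univ j) h
    · intro μ _ hμ
      exact Finset.sum_eq_zero fun ν _ => by simp [Ne.symm hμ]
    · intro h; exact absurd (Finset.mem_univ l) h

/-- The sandwich Lie algebra annihilates `⟨n,n,n⟩` (easy direction of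
`lieStab_matMulTensor_iff`): `(-(p ⊗ 1 + 1 ⊗ qᵀ), pᵀ ⊗ 1 + 1 ⊗ r, -(rᵀ ⊗ 1) + 1 ⊗ q)` is in the
Lie stabiliser. [folklore] -/
theorem lieAct_sandwich_matMulTensor {R : Type*} [CommRing R] (p q r : Matrix (Fin n) (Fin n) R) :
    actTensor (-(p ⊗ₖ (1 : Matrix (Fin n) (Fin n) R) + (1 : Matrix (Fin n) (Fin n) R) ⊗ₖ qᵀ))
        (1 : Matrix (Fin n × Fin n) (Fin n × Fin n) R) 1 (matMulTensor R n n n) +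
      actTensor (1 : Matrix (Fin n × Fin n) (Fin n × Fin n) R)
        (pᵀ ⊗ₖ (1 : Matrix (Fin n) (Fin n) R) + (1 : Matrix (Fin n) (Fin n) R) ⊗ₖ r) 1
        (matMulTensor R n n n) +
      actTensor (1 : Matrix (Fin n × Fin n) (Fin n × Fin n) R) 1
        (-(rᵀ ⊗ₖ (1 : Matrix (Fin n) (Fin n) R)) + (1 : Matrix (Fin n) (Fin n) R) ⊗ₖ q)
        (matMulTensor R n n n) = 0 := by
  funext a b c
  obtain ⟨i, j⟩ := a
  obtain ⟨k, l⟩ := b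
  obtain ⟨m, o⟩ := c
  rw [lieAct_matMulTensor_apply]
  simp only [Pi.zero_apply, Matrix.neg_apply, Matrix.add_apply, kronecker_apply, transpose_apply]
  rcases eq_or_ne l m with rfl | h₁ <;> rcases eq_or_ne j o with rfl | h₂ <;>
    rcases eq_or_ne i k with rfl | h₃
  · simp only [if_true, Matrix.one_apply_eq]; ring
  · simp only [if_true, Matrix.one_apply_eq, if_neg h₃, Matrix.one_apply_ne h₃,
      Matrix.one_apply_ne (Ne.symm h₃)]; ring
  · simp only [if_true, Matrix.one_apply_eq, if_neg h₂, Matrix.one_apply_ne h₂,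
      Matrix.one_apply_ne (Ne.symm h₂)]; ring
  · simp only [if_true, Matrix.one_apply_eq, if_neg h₂, Matrix.one_apply_ne h₂,
      Matrix.one_apply_ne (Ne.symm h₂), if_neg h₃, Matrix.one_apply_ne h₃,
      Matrix.one_apply_ne (Ne.symm h₃)]; ring
  · simp only [if_true, Matrix.one_apply_eq, if_neg h₁, Matrix.one_apply_ne h₁,
      Matrix.one_apply_ne (Ne.symm h₁)]; ring
  · simp only [if_true, Matrix.one_apply_eq, if_neg h₁, Matrix.one_apply_ne h₁,
      Matrix.one_apply_ne (Ne.symm h₁), if_neg h₃, Matrix.one_apply_ne h₃,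
      Matrix.one_apply_ne (Ne.symm h₃)]; ring
  · simp only [if_true, Matrix.one_apply_eq, if_neg h₁, Matrix.one_apply_ne h₁,
      Matrix.one_apply_ne (Ne.symm h₁), if_neg h₂, Matrix.one_apply_ne h₂,
      Matrix.one_apply_ne (Ne.symm h₂)]; ring
  · simp only [if_neg h₁, Matrix.one_apply_ne h₁, Matrix.one_apply_ne (Ne.symm h₁), if_neg h₂,
      Matrix.one_apply_ne h₂, Matrix.one_apply_ne (Ne.symm h₂), if_neg h₃, Matrix.one_apply_ne h₃,
      Matrix.one_apply_ne (Ne.symm h₃)]; ring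

/-- **The Lie stabiliser of `⟨n,n,n⟩` in `gl_{n²} ⊕ gl_{n²} ⊕ gl_{n²}`** (de Groote 1978, I,
infinitesimal form): a triple `(ξ₁, ξ₂, ξ₃)` of `n² × n²` matrices annihilates the matrix
multiplication tensor, `(ξ₁⊗1⊗1 + 1⊗ξ₂⊗1 + 1⊗1⊗ξ₃)·⟨n,n,n⟩ = 0`, iff it is tangent to the
sandwich group: `ξ₁ = -(p ⊗ₖ 1 + 1 ⊗ₖ qᵀ)`, `ξ₂ = pᵀ ⊗ₖ 1 + 1 ⊗ₖ r`, `ξ₃ = -(rᵀ ⊗ₖ 1) + 1 ⊗ₖ q`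
for some `n × n` matrices `p, q, r` (as operators on `n × n` matrices:
`Z ↦ -(pZ + Zq)`, `X ↦ pᵀX + Xrᵀ`, `Y ↦ -rᵀY + Yqᵀ`). Proof: solve the linear system of
`lieAct_matMulTensor_apply` — off the "diagonals" the entries vanish, on them they are constant in
the free index, and the fully diagonal equation `f(i,j) + g(i,l) + h(l,j) = 0` splits `g`, `h`, `f`
into row and column parts. [cite: Degroote1978, §3 (Thm. 3.3–3.4, infinitesimal form)] -/
theorem lieStab_matMulTensor_iff (ξ₁ ξ₂ ξ₃ : Matrix (Fin n × Fin n) (Fin n × Fin n) K) :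
    actTensor ξ₁ (1 : Matrix (Fin n × Fin n) (Fin n × Fin n) K) 1 (matMulTensor K n n n) +
      actTensor (1 : Matrix (Fin n × Fin n) (Fin n × Fin n) K) ξ₂ 1 (matMulTensor K n n n) +
      actTensor (1 : Matrix (Fin n × Fin n) (Fin n × Fin n) K) 1 ξ₃ (matMulTensor K n n n) = 0 ↔
    ∃ p q r : Matrix (Fin n) (Fin n) K,
      ξ₁ = -(p ⊗ₖ (1 : Matrix (Fin n) (Fin n) K) + (1 : Matrix (Fin n) (Fin n) K) ⊗ₖ qᵀ) ∧
      ξ₂ = pᵀ ⊗ₖ (1 : Matrix (Fin n) (Fin n) K) + (1 : Matrix (Fin n) (Fin n) K) ⊗ₖ r ∧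
      ξ₃ = -(rᵀ ⊗ₖ (1 : Matrix (Fin n) (Fin n) K)) + (1 : Matrix (Fin n) (Fin n) K) ⊗ₖ q := by
  constructor
  swap
  · rintro ⟨p, q, r, rfl, rfl, rfl⟩
    exact lieAct_sandwich_matMulTensor p q r
  intro h0
  rcases Nat.eq_zero_or_pos n with rfl | hn
  · refine ⟨0, 0, 0, ?_, ?_, ?_⟩ <;> exact Subsingleton.elim _ _
  -- the linear system
  have h : ∀ i j k l m o : Fin n, (if l = m then ξ₁ (i, j) (k, o) else 0) +
      (if j = o then ξ₂ (k, l) (i, m) else 0) + (if i = k then ξ₃ (m, o) (l, j) else 0) = 0 := by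
    intro i j k l m o
    rw [← lieAct_matMulTensor_apply, h0]
    rfl
  set z : Fin n := ⟨0, hn⟩ with hz
  -- consequences of the system
  have c1 : ∀ i j k o, i ≠ k → j ≠ o → ξ₁ (i, j) (k, o) = 0 := by
    intro i j k o hik hjo
    have := h i j k z z o
    simpa [hik, hjo] using this
  have c2 : ∀ i k l m, i ≠ k → l ≠ m → ξ₂ (k, l) (i, m) = 0 := by
    intro i k l m hik hlm
    have := h i z k l m z
    simpa [hik, hlm] using this
  have c3 : ∀ j l m o, l ≠ m → j ≠ o → ξ₃ (m, o) (l, j) = 0 := by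
    intro j l m o hlm hjo
    have := h z j z l m o
    simpa [hlm, hjo] using this
  have c4 : ∀ i j k l, i ≠ k → ξ₁ (i, j) (k, j) + ξ₂ (k, l) (i, l) = 0 := by
    intro i j k l hik
    have := h i j k l l j
    simpa [hik] using this
  have c5 : ∀ i j l o, j ≠ o → ξ₁ (i, j) (i, o) + ξ₃ (l, o) (l, j) = 0 := by
    intro i j l o hjo
    have := h i j i l l o
    simpa [hjo] using this
  have c6 : ∀ i j l m, l ≠ m → ξ₂ (i, l) (i, m) + ξ₃ (m, j) (l, j) = 0 := by
    intro i j l m hlm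
    have := h i j i l m j
    simpa [hlm] using this
  have c7 : ∀ i j l, ξ₁ (i, j) (i, j) + ξ₂ (i, l) (i, l) + ξ₃ (l, j) (l, j) = 0 := by
    intro i j l
    have := h i j i l l j
    simpa using this
  -- the solution
  refine ⟨Matrix.of fun i k => ξ₂ (k, z) (i, z), Matrix.of fun o j => ξ₃ (z, o) (z, j),
    Matrix.of fun l m => ξ₂ (z, l) (z, m) - if l = m then ξ₂ (z, z) (z, z) else 0, ?_, ?_, ?_⟩
  · -- `ξ₁ = -(p ⊗ 1 + 1 ⊗ qᵀ)`
    ext ⟨i, j⟩ ⟨k, o⟩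
    simp only [Matrix.neg_apply, Matrix.add_apply, kronecker_apply, Matrix.of_apply,
      transpose_apply]
    by_cases hjo : j = o
    · subst hjo
      by_cases hik : i = k
      · subst hik
        simp only [Matrix.one_apply_eq, mul_one, one_mul]
        -- `f(i,j) = -(x_i + w_j)`
        linear_combination c7 i j z
      · simp only [Matrix.one_apply_eq, mul_one, Matrix.one_apply_ne hik, zero_mul, add_zero]
        linear_combination c4 i j k z hik
    · by_cases hik : i = k
      · subst hik
        simp only [Matrix.one_apply_ne hjo, mul_zero, Matrix.one_apply_eq, one_mul, zero_add]
        linear_combination c5 i j z o hjo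
      · simp only [Matrix.one_apply_ne hjo, mul_zero, Matrix.one_apply_ne hik, zero_mul, add_zero,
          neg_zero]
        exact c1 i j k o hik hjo
  · -- `ξ₂ = pᵀ ⊗ 1 + 1 ⊗ r`
    ext ⟨k, l⟩ ⟨i, m⟩
    simp only [Matrix.add_apply, kronecker_apply, Matrix.of_apply, transpose_apply]
    by_cases hlm : l = m
    · subst hlm
      by_cases hki : k = i
      · subst hki
        simp only [Matrix.one_apply_eq, mul_one, one_mul, if_true]
        -- `g(k,l) = x_k + u_l`
        have e1 := c7 k z l
        have e2 := c7 k z z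
        have e3 := c7 z z l
        have e4 := c7 z z z
        linear_combination e1 - e2 - e3 + e4
      · simp only [Matrix.one_apply_eq, mul_one, Matrix.one_apply_ne hki, zero_mul, add_zero]
        -- independence of `l`: `ξ₂ (k,l)(i,l) = -ξ₁ (i,j)(k,j)` for all `j, l`
        have e1 := c4 i z k l (Ne.symm hki)
        have e2 := c4 i z k z (Ne.symm hki)
        linear_combination e1 - e2
    · by_cases hki : k = i
      · subst hki
        simp only [Matrix.one_apply_ne hlm, mul_zero, Matrix.one_apply_eq, one_mul, zero_add, hlm,
          if_false, sub_zero]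
        have e1 := c6 k z l m hlm
        have e2 := c6 z z l m hlm
        linear_combination e1 - e2
      · simp only [Matrix.one_apply_ne hlm, mul_zero, Matrix.one_apply_ne hki, zero_mul, add_zero]
        exact c2 i k l m (Ne.symm hki) hlm
  · -- `ξ₃ = -(rᵀ ⊗ 1) + 1 ⊗ q`
    ext ⟨m, o⟩ ⟨l, j⟩
    simp only [Matrix.add_apply, Matrix.neg_apply, kronecker_apply, Matrix.of_apply, transpose_apply]
    by_cases hoj : o = j
    · subst hoj
      by_cases hml : m = l
      · subst hml
        simp only [Matrix.one_apply_eq, mul_one, one_mul, if_true]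
        -- `h(m,o) = w_o - u_m`
        have e1 := c7 z o m
        have e2 := c7 z o z
        linear_combination e1 - e2
      · simp only [Matrix.one_apply_eq, mul_one, Matrix.one_apply_ne hml, zero_mul, add_zero,
          Ne.symm hml, if_false, sub_zero]
        linear_combination c6 z o l m (Ne.symm hml)
    · by_cases hml : m = l
      · subst hml
        simp only [Matrix.one_apply_ne hoj, mul_zero, neg_zero, Matrix.one_apply_eq, one_mul, zero_add]
        have e1 := c5 z j m o (Ne.symm hoj)
        have e2 := c5 z j z o (Ne.symm hoj)
        linear_combination e1 - e2
      · simp only [Matrix.one_apply_ne hoj, mul_zero, neg_zero, Matrix.one_apply_ne hml, zero_mul,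
          add_zero]
        exact c3 j l m o (Ne.symm hml) (Ne.symm hoj)

end Literature.Computability.AlgebraicComplexity
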